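/-
Copyright (c) 2026. All rights reserved.
Released under Apache 2.0 license as described in the file LICENSE.
Authors: HodgeCM publication cell (pub-hodgecm), GR lane, seat GR-2 (`pub-hodgecm-own-hyp34`).
-/
import Literature.NumberTheory.Automorphic.QuadExtTotallyComplexPlaces
import HarnessLib

/-!
# A place of `E` above each archimedean place of `F`, for a GENERAL quadratic extension `E/F`: the three place types

Twin of `QuadExtTotallyComplexPlaces` §2 without `[IsTotallyComplex E]`.  For a quadratic extension of number fields
`E/F` with Galois involution `c` choose, above every infinite place `v` of `F`, a place `placeAbove v` of `E`.  The real
places of `F` then fall into TYPE (i) (`IsTypeOne v`: `placeAbove v` is complex — `E_v = ℂ`, `v` ramifies in `E`) and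
TYPE (ii) (`placeAbove v` is real — `E_v = ℝ × ℝ`, `v` splits in `E`); a place above a complex place is complex
(TYPE (iii), `E_v = ℂ × ℂ`).  The file packages the three families of chosen places with their types:

* `placeAboveOne k` (complex, `c`-fixed: `smul_placeAboveOne`, by `smul_eq_of_isComplex_of_isReal_comap`) over the
  type-(i) real places, `placeAboveTwo k` (real) over the type-(ii) real places, `placeAboveComplex v` (complex) over the
  complex places, each with its `…_comap` lemma.

These are the canonical data `p := IsTypeOne`, `wOf₁ := placeAboveOne`, `wOf₂ := placeAboveTwo`,
`wOf := placeAboveComplex` of the three-block archimedean Weil section of a unitary group over a general `E/F`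
(`Weil1964/ArchUnitaryWeilHalf3`).  KERNEL MATHEMATICS ONLY: definitions with bodies and theorems; no `def … : Prop`
record of a cited statement, no axiom, no `sorry`.

## References
* [CasselsFrohlichANT1967] J. W. S. Cassels, A. Fröhlich (eds.), *Algebraic Number Theory* (1967), Ch. II §14.
* [PlatonovRapinchuk1994] V. Platonov, A. Rapinchuk, *Algebraic Groups and Number Theory* (1994), §2.3.
-/

set_option autoImplicit false

noncomputable section

open scoped Classical
open NumberField NumberField.InfinitePlace

namespace Literature.NumberTheory.Automorphic

namespace UnitaryGroup

variable (F : Type) [Field F] [NumberField F] (E : Type) [Field E] [NumberField E] [Algebra F E]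
  [Algebra.IsQuadraticExtension F E] (c : E ≃ₐ[F] E)

/-! ## §1 A chosen place above every archimedean place -/

/-- **a place of `E` above the infinite place `v` of `F`** (a choice). [cite: CasselsFrohlichANT1967, Ch. II §14] -/
def placeAbove (v : InfinitePlace F) : InfinitePlace E := (Classical.choice (InfPlacesOver.nonempty E v)).1

/-- it lies above `v`. [cite: CasselsFrohlichANT1967, Ch. II §14] -/
theorem placeAbove_comap (v : InfinitePlace F) : (placeAbove F E v).comap (algebraMap F E) = v :=
  (Classical.choice (InfPlacesOver.nonempty E v)).2

omit [NumberField F] [NumberField E] [Algebra.IsQuadraticExtension F E] in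
/-- a place above a complex place is complex. [cite: CasselsFrohlichANT1967, Ch. II §14] -/
theorem isComplex_of_comap_isComplex {w : InfinitePlace E} {v : InfinitePlace F} (h : w.comap (algebraMap F E) = v)
    (hv : v.IsComplex) : w.IsComplex := by
  rw [← not_isReal_iff_isComplex]
  intro hw
  have h1 : (w.comap (algebraMap F E)).IsReal := hw.comap _
  rw [h] at h1
  exact (not_isReal_iff_isComplex.2 hv) h1

/-! ## §2 The three place types -/

/-- **TYPE (i)**: the real place `v` of `F` has a complex place of `E` above it (`E_v = ℂ`; `v` ramifies in `E`).
[cite: PlatonovRapinchuk1994, §2.3] -/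
def IsTypeOne (v : {v : InfinitePlace F // v.IsReal}) : Prop := (placeAbove F E v.1).IsComplex

/-- **the complex place above a type-(i) real place.** [cite: CasselsFrohlichANT1967, Ch. II §14] -/
def placeAboveOne (k : {v : {v : InfinitePlace F // v.IsReal} // IsTypeOne F E v}) :
    {w : InfinitePlace E // w.IsComplex} :=
  ⟨placeAbove F E k.1.1, k.2⟩

/-- it lies above `v`. [cite: CasselsFrohlichANT1967, Ch. II §14] -/
theorem placeAboveOne_comap (k : {v : {v : InfinitePlace F // v.IsReal} // IsTypeOne F E v}) :
    (placeAboveOne F E k).1.comap (algebraMap F E) = k.1.1 :=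
  placeAbove_comap F E k.1.1

/-- **it is fixed by the involution**: `c • w = w`. [cite: PlatonovRapinchuk1994, §2.3] -/
theorem smul_placeAboveOne (k : {v : {v : InfinitePlace F // v.IsReal} // IsTypeOne F E v}) :
    c • (placeAboveOne F E k).1 = (placeAboveOne F E k).1 :=
  smul_eq_of_isComplex_of_isReal_comap F E c _ (placeAboveOne F E k).2 (by rw [placeAboveOne_comap]; exact k.1.2)

/-- **the real place above a type-(ii) real place** (`E_v = ℝ × ℝ`; the other place above `v` is `c • w`).
[cite: CasselsFrohlichANT1967, Ch. II §14] -/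
def placeAboveTwo (k : {v : {v : InfinitePlace F // v.IsReal} // ¬ IsTypeOne F E v}) :
    {w : InfinitePlace E // w.IsReal} :=
  ⟨placeAbove F E k.1.1, not_isComplex_iff_isReal.1 k.2⟩

/-- it lies above `v`. [cite: CasselsFrohlichANT1967, Ch. II §14] -/
theorem placeAboveTwo_comap (k : {v : {v : InfinitePlace F // v.IsReal} // ¬ IsTypeOne F E v}) :
    (placeAboveTwo F E k).1.comap (algebraMap F E) = k.1.1 :=
  placeAbove_comap F E k.1.1

/-- **the (complex) place above a complex place** (`E_v = ℂ × ℂ`; the other one is `c • w`).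
[cite: CasselsFrohlichANT1967, Ch. II §14] -/
def placeAboveComplex (v : {v : InfinitePlace F // v.IsComplex}) : {w : InfinitePlace E // w.IsComplex} :=
  ⟨placeAbove F E v.1, isComplex_of_comap_isComplex F E (placeAbove_comap F E v.1) v.2⟩

/-- it lies above `v`. [cite: CasselsFrohlichANT1967, Ch. II §14] -/
theorem placeAboveComplex_comap (v : {v : InfinitePlace F // v.IsComplex}) :
    (placeAboveComplex F E v).1.comap (algebraMap F E) = v.1 :=
  placeAbove_comap F E v.1

/-- for `E` totally complex every real place of `F` is of type (i). [cite: CasselsFrohlichANT1967, Ch. II §14] -/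
theorem isTypeOne_of_isTotallyComplex [IsTotallyComplex E] (v : {v : InfinitePlace F // v.IsReal}) : IsTypeOne F E v :=
  IsTotallyComplex.isComplex _

end UnitaryGroup

end Literature.NumberTheory.Automorphic

end
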